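import Summits.QuantumFields.YangMills.Theorems.BalabanUVNodesN06Row17LocalCentreTwoLevelOfLev
import Literature.MathematicalPhysics.QuantumFieldTheory.Balaban1983to89.B9LocalLemma24TwoLevelCollarChartY
import Literature.MathematicalPhysics.QuantumFieldTheory.Balaban1983to89.B9LocalCubeGeometryChartY

/-!
# BalabanUVNodes ∕ N06 ([B9], `Dag.B9_main`) — ROW 17's LOCAL CENTRE NUMBER `m_□` AND LOCAL CLAUSE AT EVERY ENLARGED CUBE `□̃(c)` OF THE COVER FROM THE `KIdx`
# FIELDS ALONE: the `hco` binder of the local road at `U = 1` and `hloc(U)` on print's class (3.35) with the label margins `hmargS`∕`hmargT` of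
# `…LocalCentreEveryCube` DISCHARGED through a chart of the torus (`B9LocalCubeGeometryChartY.exists_chart_margins_cubeDomY`) — NO geometric display left

Track A of `YM-PLAN.md` (cell `pub-ymgap`, HUMAN RULING D-0062), node **N06** = [Balaban1985BackgroundPropagators] Thms 3.1–3.15; seat `pub-ymgap-dag-n06-j`
(bundle F5, rows 15–17), g27.  A HELPER (count-neutral, `--supports` only).

THE PRINT.  [B9] p. 416 (proof of Thm 3.11): *«In [4] we have proved that the operator G_□(1) is positive»*; [4] = [Balaban1984PropagatorsII] p. 238: *«we take the cube
□̃³ and identify it with a torus T_□»*, (2.2) p. 224, (2.89) p. 239, Lemma 2.4 (2.128) p. 245.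

WHAT.  g26 (`…LocalCentreEveryCube`) gave row 17's two faces for EVERY cube GIVEN the label margins «one big block off the box boundary» of the `Λ_j`-blocks inside `□̃(c)`
and of the `Λ_{j+1}`-blocks around it (`hmargS`, `hmargT`) — true off the seam of the global chart, FALSE for the cubes meeting it.  This seat's g27 chain removes them:
`B6SectALemma24TwoLevelV1SitesChart` (C6d's two-level Lemma-2.4 letter transported along r03's `IsTr` translation covariance: margins in ANY chart of the torus),
`B9LocalLemma24TwoLevelCollarChartY` (g25's collar construction feeding it), `B9LocalCubeGeometryChartY` (for every cube a chart placing `□̃(c)` and its collar off the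
seam: p38's canonical chart below the top level, a re-centred one for top cubes using `KIdx.hpl`).  THIS FILE composes:
* ★★ `coer_trIP_padDeltaALocY_one_of_twoLevel_of_lev_chart` — p669030's `…_of_twoLevel_of_lev` with the margins in the frame of a chart `s`.
* ★★★ `coer_trIP_padDeltaALocY_one_cubeDomY_of_KIdx` — for EVERY member `x` and EVERY cover cube `c`, given ONLY `2 ≤ d+1`, `0 < b₀` and 0∕1 cuts with `χ` issuing
  from `□̃(c)`: **`min 1 γ₂(k−1) · ⟨Ψ,Ψ⟩₁ ≤ ⟨Ψ, padDeltaALocY x.toKIdx parSymY parBY (cubeDomY x c) (cutMulY χP) (cutMulY χ) 1 Ψ⟩₁` for EVERY `Ψ`** — the `hco` binder of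
  the road of record at `U = 1`, member-uniform `m_□ = min 1 γ₂(k−1)`, NO geometric hypothesis (window `exists_twoLevel_window_cubeDomY`, chart `exists_chart_margins_cubeDomY`).
* ★★★ `posDefTr_padDeltaALocY_of_L5_of_regYP335_of_KIdx` — `hloc(U)` on (3.35) at every cube from L5's pencil letters, the fibre count, the radius inequalities at
  `m_□ = min 1 γ₂(k−1)` and the (3.35) comparison — g26's face with `hmargS hmargT` GONE.
HONEST FRAMING.  Compositions over landed files; after this file row 17's local road displays NO cube geometry — the remaining displays are L5's analytic letters
(`hA`, `hfib`, radii, `hCr`) and the (3.35) class; constants dag-n10-c's (level-dependent, uniformised at `j = k − 1`); COUNT-NEUTRAL; N06 ∕ N10 NOT discharged; nothing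
continuum ∕ OS ∕ mass gap ∕ Clay.  0 `def`, 0 `sorry`.
-/
noncomputable section

namespace Summit.QuantumFields.YangMills.BalabanUVNodes.N06Row17LocalCentreEveryCubeOfKIdx

open Finset
open Literature.MathematicalPhysics.QuantumFieldTheory.Balaban1983to89
open Literature.MathematicalPhysics.QuantumFieldTheory.Balaban1983to89.Node00
open Literature.MathematicalPhysics.QuantumFieldTheory.Balaban1983to89.Node00.OpsYDeltaALocal (padDeltaALocY)
open Literature.MathematicalPhysics.QuantumFieldTheory.Balaban1983to89.B9Thm311ReadingCoords (trIP PosDefTr)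
open Literature.MathematicalPhysics.QuantumFieldTheory.Balaban1983to89.B9Thm37CubeCoverCommutators (cutMulY)
open Literature.MathematicalPhysics.QuantumFieldTheory.Balaban1983to89.B6KLevelCensusIndexV1 (KIdx kGeo)
open Literature.MathematicalPhysics.QuantumFieldTheory.Balaban1983to89.B6GlobalChartV1 (PV domT toBox boxEquiv)
open Literature.MathematicalPhysics.QuantumFieldTheory.Balaban1983to89.B5Eq118OneStroke (iterBlock iterBlockOf)
open Literature.MathematicalPhysics.QuantumFieldTheory.Balaban1983to89.Node00.OpsYNablaBridge (chartY)
open Literature.MathematicalPhysics.QuantumFieldTheory.Balaban1983to89.B9BackgroundsKLevelV1 (CfgV1)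
open Literature.MathematicalPhysics.QuantumFieldTheory.Balaban1983to89.B9BackgroundsKLevelV1P (bg9YP)
open Literature.MathematicalPhysics.QuantumFieldTheory.Balaban1983to89.B9PinMembersKLevelV1 (MemberY)
open Literature.MathematicalPhysics.QuantumFieldTheory.Balaban1983to89.B6Cover236MultiLevelBlocks (cubes)
open Literature.MathematicalPhysics.QuantumFieldTheory.Balaban1983to89.B9WalkLettersCoordsS (cubeDomY)
open Literature.MathematicalPhysics.QuantumFieldTheory.Balaban1983to89.LatticeNorms (scaleLen)
open Literature.MathematicalPhysics.QuantumFieldTheory.Balaban1983to89.B5TorusCover (UT)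
open Literature.MathematicalPhysics.QuantumFieldTheory.Balaban1983to89.B13EntrywiseWalks (RawEntryLetters)
open Literature.MathematicalPhysics.QuantumFieldTheory.Balaban1983to89.B9Eq39Adjoint (prodCfg)
open Literature.MathematicalPhysics.QuantumFieldTheory.Balaban1983to89.B9LocalCubeGeometryTwoLevelWindowY (exists_twoLevel_window_cubeDomY)
open Literature.MathematicalPhysics.QuantumFieldTheory.Balaban1983to89.B9LocalCubeGeometryChartY (exists_chart_margins_cubeDomY)
open Literature.MathematicalPhysics.QuantumFieldTheory.Balaban1983to89.B9LocalLemma24TwoLevelCollarChartY (local_lemma24_real_twoLevel_of_lev_chart)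
open Literature.MathematicalPhysics.QuantumFieldTheory.Balaban1983to89.B9LocalLemma24TwoLevelAtLettersY (local_lemma24_twoLevel_const_pos)
open Literature.MathematicalPhysics.QuantumFieldTheory.Balaban1983to89.B9LocalCubeGeometryOneLevelY (cubeDomY_dichotomy_lamSite chartY_eq_toBox)
open Literature.MathematicalPhysics.QuantumFieldTheory.Balaban1983to89.B9DeltaAOneCoerciveOneLevelY (w_lower_of_globalBand)
open Literature.MathematicalPhysics.QuantumFieldTheory.Balaban1983to89.B6SectALemma24OneLevelV1 (cornerV1)
open Literature.MathematicalPhysics.QuantumFieldTheory.Balaban1983to89.LatticeFieldCalculus (stairSum)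
open Literature.MathematicalPhysics.QuantumFieldTheory.Balaban1983to89.B6TranslateV1 (tv)
open Literature.MathematicalPhysics.QuantumFieldTheory.Balaban1983to89.B6MultiLevelTorusOperator (TDomains)
open Literature.MathematicalPhysics.QuantumFieldTheory.Balaban1983to89.B9Thm311DeltaPrimePos (trIP_self_nonneg)
open Summit.QuantumFields.YangMills.BalabanUVNodes.N06Row17LocalCentreOfLemma24 (coer_trIP_padDeltaALocY_one_of_lemma24_letter)
open Summit.QuantumFields.YangMills.BalabanUVNodes.N06Row17LocalClauseOnReg335OfL5 (posDefTr_padDeltaALocY_of_L5_of_regYP335)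
open Summit.QuantumFields.YangMills.BalabanUVNodes.N06Row17LocalCentreTwoLevelOfLev (gamma_twoLevel_antitone)
open scoped Matrix
open scoped Matrix.Norms.L2Operator

variable {N : ℕ} {d ℓ : ℕ} {hd : 1 ≤ d + 1} {hL : Odd (ℓ + 1) ∧ 1 < ℓ + 1} {b₀ b₁ : ℝ} {Mstar : ℕ}
variable {ν : ℕ} {Nf : Fin ν → ℕ} [∀ j, NeZero (Nf j)]

/-- ★★ **ROW 17's LOCAL CENTRE NUMBER AT A TWO-LEVEL SITE SET, `U = 1`, MARGINS IN A CHART OF THE TORUS** — p669030's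
`…LocalCentreTwoLevelOfLev.coer_trIP_padDeltaALocY_one_of_twoLevel_of_lev` VERBATIM except that the label margins `hmargS`∕`hmargT` are asked of the TRANSLATED labels
`y − tv (tvec s) j`, `Y − tv (tvec s) (j+1)` of a chart `s` (the site set may wrap around the seam of the global chart):
**`min 1 γ₂ · ⟨Ψ,Ψ⟩₁ ≤ ⟨Ψ, padDeltaALocY i parSymY parBY D (cutMulY χP) (cutMulY χ) 1 Ψ⟩₁`** — `coer_trIP_padDeltaALocY_one_of_lemma24_letter` ∘ `local_lemma24_real_twoLevel_of_lev_chart`.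
[cite: Balaban1985BackgroundPropagators, Thm 3.11 proof p.416, Cor. 3.6 p.408, pp.408–409; Balaban1984PropagatorsII, p.238 (T_□), (2.89) p.239, Lemma 2.4 (2.128) p.245, (2.2)–(2.4) p.224, (2.11) p.225] -/
theorem coer_trIP_padDeltaALocY_one_of_twoLevel_of_lev_chart (i : KIdx d ℓ hd hL b₀ b₁) (hd2 : 2 ≤ d + 1) {j : ℕ} (hjk : j + 1 ≤ i.k) (D : Finset (SiteY i))
    (hD : ∀ (j' : ℕ) (y : Site (PV d ℓ i.m i.K hd hL) j'), (domT i.hN i.D i.hk).LamSite j' y →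
      (∀ x ∈ iterBlock j' y, chartY i x ∈ D) ∨ (∀ x ∈ iterBlock j' y, chartY i x ∉ D))
    (h2 : ∀ x : Site (PV d ℓ i.m i.K hd hL) 0, chartY i x ∈ D →
      i.D.lev (toBox i.hN x : Fin (d + 1) → ℤ) = j ∨ i.D.lev (toBox i.hN x : Fin (d + 1) → ℤ) = j + 1)
    (hNbr2 : ∀ Y₀ Y₁ Y₂ : Site (PV d ℓ i.m i.K hd hL) (j + 1),
      (∃ x : Site (PV d ℓ i.m i.K hd hL) 0, iterBlockOf (j + 1) x = Y₀ ∧ chartY i x ∈ D) →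
      (Y₁ = Y₀ ∨ ∃ μ, Y₁ = Y₀.shift μ ∨ Y₀ = Y₁.shift μ) → (Y₂ = Y₁ ∨ ∃ μ, Y₂ = Y₁.shift μ ∨ Y₁ = Y₂.shift μ) →
      ∀ y : Site (PV d ℓ i.m i.K hd hL) 0, iterBlockOf (j + 1) y = Y₂ → i.D.lev (toBox i.hN y : Fin (d + 1) → ℤ) ≤ j + 1)
    (s : Fin (d + 1) → ℤ)
    (hmargS : ∀ y : Site (PV d ℓ i.m i.K hd hL) j, (domT i.hN i.D i.hk).LamSite j y → (∃ x ∈ iterBlock j y, chartY i x ∈ D) →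
      ∀ μ, (ℓ + 1) ^ (j + 1) ≤ ((y - tv (PV d ℓ i.m i.K hd hL) (TDomains.tvec ℓ i.Mh i.k s) j) μ).val * (ℓ + 1) ^ j ∧
        ((y - tv (PV d ℓ i.m i.K hd hL) (TDomains.tvec ℓ i.Mh i.k s) j) μ).val * (ℓ + 1) ^ j + (ℓ + 1) ^ j + (ℓ + 1) ^ (j + 1) ≤ (PV d ℓ i.m i.K hd hL).sitesPerDir 0)
    (hmargT : ∀ Y : Site (PV d ℓ i.m i.K hd hL) (j + 1), (domT i.hN i.D i.hk).LamSite (j + 1) Y →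
      (∃ Y₀ : Site (PV d ℓ i.m i.K hd hL) (j + 1), (∃ x : Site (PV d ℓ i.m i.K hd hL) 0, iterBlockOf (j + 1) x = Y₀ ∧ chartY i x ∈ D) ∧
        (Y = Y₀ ∨ ∃ μ, Y = Y₀.shift μ ∨ Y₀ = Y.shift μ)) →
      ∀ μ, (ℓ + 1) ^ (j + 1) ≤ ((Y - tv (PV d ℓ i.m i.K hd hL) (TDomains.tvec ℓ i.Mh i.k s) (j + 1)) μ).val * (ℓ + 1) ^ (j + 1) ∧
        ((Y - tv (PV d ℓ i.m i.K hd hL) (TDomains.tvec ℓ i.Mh i.k s) (j + 1)) μ).val * (ℓ + 1) ^ (j + 1) + 2 * (ℓ + 1) ^ (j + 1) ≤ (PV d ℓ i.m i.K hd hL).sitesPerDir 0)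
    {w₀ : ℝ} (hw₀ : 0 < w₀) (hw : ∀ ι : IBondY i, w₀ ≤ i.w ι)
    {χP : BlkY i → ℝ} (hχP : ∀ y, χP y = 0 ∨ χP y = 1) {χ : FBondY i → ℝ} (hχ : ∀ b, χ b = 0 ∨ χ b = 1)
    (hχD : ∀ b, χ b ≠ 0 → chartY i b.src ∈ D) (Ψ : FBondY i → Matrix (Fin N) (Fin N) ℂ) :
    min 1 (2 / ((12 * (((d + 1 : ℕ) : ℝ)) ^ 2 * (1 + 12 * (((d + 1 : ℕ) : ℝ)) * ((((ℓ + 1 : ℕ) : ℝ)) ^ j) ^ 2))⁻¹ *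
              (((((ℓ + 1 : ℕ) : ℝ)) ^ (j + 1)) ^ (d + 1 + 1))⁻¹ * min (i.cf ^ 2 / 2) (w₀ / ((((ℓ + 1 : ℕ) : ℝ)) ^ (j + 1)) ^ (d + 1 - 2))) +
          4 / (8 * i.cf ^ 2 / ((((ℓ + 1 : ℕ) : ℝ)) ^ i.k) ^ 2) *
            (1 + 4 * ((d + 1 : ℕ) : ℝ) * i.cf ^ 2 /
              ((12 * (((d + 1 : ℕ) : ℝ)) ^ 2 * (1 + 12 * (((d + 1 : ℕ) : ℝ)) * ((((ℓ + 1 : ℕ) : ℝ)) ^ j) ^ 2))⁻¹ *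
                (((((ℓ + 1 : ℕ) : ℝ)) ^ (j + 1)) ^ (d + 1 + 1))⁻¹ * min (i.cf ^ 2 / 2) (w₀ / ((((ℓ + 1 : ℕ) : ℝ)) ^ (j + 1)) ^ (d + 1 - 2)))))⁻¹ *
        trIP (fun _ => (1 : ℝ)) Ψ Ψ ≤
      trIP (fun _ => (1 : ℝ)) Ψ
        (padDeltaALocY i (parSymY i) (parBY i) D (cutMulY χP) (cutMulY χ) (fun _ _ => 1 : CfgY (Matrix (Fin N) (Fin N) ℂ) i) Ψ) :=
  coer_trIP_padDeltaALocY_one_of_lemma24_letter i D hD hχP hχ hχD (local_lemma24_twoLevel_const_pos i j hw₀)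
    (fun v hst hoff => local_lemma24_real_twoLevel_of_lev_chart i hd2 hjk D s hD h2 hNbr2 hmargS hmargT hw₀ hw v hst hoff) Ψ

/-- ★★★ **ROW 17's LOCAL CENTRE NUMBER AT EVERY ENLARGED CUBE `□̃(c)`, `U = 1`, FROM THE `KIdx` FIELDS ALONE.**  For EVERY member `x` and EVERY cover cube `c`, given
only `2 ≤ d + 1`, `0 < b₀`, and 0∕1 cuts `χP`, `χ` with `χ` issuing from `□̃(c)`:
**`min 1 γ₂(k−1) · ⟨Ψ,Ψ⟩₁ ≤ ⟨Ψ, padDeltaALocY x.toKIdx parSymY parBY (cubeDomY x c) (cutMulY χP) (cutMulY χ) 1 Ψ⟩₁` for EVERY `Ψ`** — the `hco` binder of the road of record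
at `U = 1` with the member-uniform `m_□ = min 1 γ₂(k−1)`.  The level window `{j, j+1}` of `□̃(c)` and its collar condition (`exists_twoLevel_window_cubeDomY`, from `2L² ≤ R`)
AND the label margins (`exists_chart_margins_cubeDomY`: a chart of the torus placing `□̃(c)` and its collar one big block off the seam) are THEOREMS — no geometric hypothesis.
[cite: Balaban1985BackgroundPropagators, Thm 3.11 proof p.416, Cor. 3.6 p.408, pp.408–409 (G_□, □̃); Balaban1984PropagatorsII, p.238 (T_□), (2.2) p.224, (2.89) p.239, Lemma 2.4 (2.128) p.245, (2.16) p.225] -/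
theorem coer_trIP_padDeltaALocY_one_cubeDomY_of_KIdx (x : MemberY d ℓ hd hL b₀ b₁ Mstar) (c : ↥(cubes x.toKIdx.D.toDomains)) (hd2 : 2 ≤ d + 1)
    (hb₀ : 0 < b₀) {χP : BlkY x.toKIdx → ℝ} (hχP : ∀ y, χP y = 0 ∨ χP y = 1) {χ : FBondY x.toKIdx → ℝ} (hχ : ∀ b, χ b = 0 ∨ χ b = 1)
    (hχD : ∀ b, χ b ≠ 0 → chartY x.toKIdx b.src ∈ cubeDomY x c) (Ψ : FBondY x.toKIdx → Matrix (Fin N) (Fin N) ℂ) :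
    min 1 (2 / ((12 * (((d + 1 : ℕ) : ℝ)) ^ 2 * (1 + 12 * (((d + 1 : ℕ) : ℝ)) * ((((ℓ + 1 : ℕ) : ℝ)) ^ (x.toKIdx.k - 1)) ^ 2))⁻¹ *
              (((((ℓ + 1 : ℕ) : ℝ)) ^ (x.toKIdx.k - 1 + 1)) ^ (d + 1 + 1))⁻¹ *
                min (x.toKIdx.cf ^ 2 / 2) (b₀ * x.toKIdx.cf ^ 2 / ((((ℓ + 1 : ℕ) : ℝ)) ^ (x.toKIdx.k - 1 + 1)) ^ (d + 1 - 2))) +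
          4 / (8 * x.toKIdx.cf ^ 2 / ((((ℓ + 1 : ℕ) : ℝ)) ^ x.toKIdx.k) ^ 2) *
            (1 + 4 * ((d + 1 : ℕ) : ℝ) * x.toKIdx.cf ^ 2 /
              ((12 * (((d + 1 : ℕ) : ℝ)) ^ 2 * (1 + 12 * (((d + 1 : ℕ) : ℝ)) * ((((ℓ + 1 : ℕ) : ℝ)) ^ (x.toKIdx.k - 1)) ^ 2))⁻¹ *
                (((((ℓ + 1 : ℕ) : ℝ)) ^ (x.toKIdx.k - 1 + 1)) ^ (d + 1 + 1))⁻¹ *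
                  min (x.toKIdx.cf ^ 2 / 2) (b₀ * x.toKIdx.cf ^ 2 / ((((ℓ + 1 : ℕ) : ℝ)) ^ (x.toKIdx.k - 1 + 1)) ^ (d + 1 - 2)))))⁻¹ *
        trIP (fun _ => (1 : ℝ)) Ψ Ψ ≤
      trIP (fun _ => (1 : ℝ)) Ψ
        (padDeltaALocY x.toKIdx (parSymY x.toKIdx) (parBY x.toKIdx) (cubeDomY x c) (cutMulY χP) (cutMulY χ)
          (fun _ _ => 1 : CfgY (Matrix (Fin N) (Fin N) ℂ) x.toKIdx) Ψ) := by
  obtain ⟨j, hjk, hjc, h2, hNbr2⟩ := exists_twoLevel_window_cubeDomY x c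
  obtain ⟨s, hmargS, hmargT⟩ := exists_chart_margins_cubeDomY x c hjk hjc
  exact le_trans (mul_le_mul_of_nonneg_right
      (min_le_min_left 1 (gamma_twoLevel_antitone x.toKIdx (mul_pos hb₀ (sq_pos_iff.mpr x.toKIdx.hcf)) (show j ≤ x.toKIdx.k - 1 by omega)))
      (trIP_self_nonneg _ (fun _ => one_pos) Ψ))
    (coer_trIP_padDeltaALocY_one_of_twoLevel_of_lev_chart x.toKIdx hd2 hjk (cubeDomY x c) (cubeDomY_dichotomy_lamSite x c)
      (fun y hy => h2 _ (by rw [chartY_eq_toBox] at hy; exact hy)) hNbr2 s hmargS hmargT (mul_pos hb₀ (sq_pos_iff.mpr x.toKIdx.hcf))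
      (fun ι => w_lower_of_globalBand x.toKIdx hd2 hb₀.le ι) hχP hχ hχD Ψ)

/-- ★★★ **ROW 17's LOCAL CLAUSE ON (3.35) AT EVERY ENLARGED CUBE `□̃(c)`, FROM THE `KIdx` FIELDS AND L5's LETTERS**: `hloc(U)` for `U` in print's class from L5's
pencil letters `hA`, the fibre count `hfib`, the radius inequalities `hR′ hR′R`, `hsmall` at `m_□ = min 1 γ₂(k−1)` and the (3.35) comparison `hCr` — for EVERY cover cube,
given only `2 ≤ d + 1`, `0 < b₀` and 0∕1 cuts with `χ` issuing from `□̃(c)`; the level window, the collar condition AND the label margins are theorems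
(`…LocalClauseOnReg335OfL5Letters.posDefTr_padDeltaALocY_of_L5_of_regYP335` ∘ `coer_trIP_padDeltaALocY_one_cubeDomY_of_KIdx`).
[cite: Balaban1985BackgroundPropagators, Thm 3.11 proof p.416, Cor. 3.6 p.408, (3.35) p.396, pp.408–410; Balaban1984PropagatorsII, p.238 (T_□), (2.2) p.224, (2.89) p.239, Lemma 2.4 (2.128) p.245; Balaban1988RG2Cluster, p.15] -/
theorem posDefTr_padDeltaALocY_of_L5_of_regYP335_of_KIdx [Nonempty (Fin N)] {G : Subgroup (Matrix (Fin N) (Fin N) ℂ)ˣ}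
    (x : MemberY d ℓ hd hL b₀ b₁ Mstar) (c : ↥(cubes x.toKIdx.D.toDomains)) {χP : BlkY x.toKIdx → ℝ} (hχP : ∀ y, χP y = 0 ∨ χP y = 1)
    {χ : FBondY x.toKIdx → ℝ} (hχ : ∀ b, χ b = 0 ∨ χ b = 1) (hχD : ∀ b, χ b ≠ 0 → boxEquiv x.toKIdx.hN b.src ∈ cubeDomY x c)
    (hd2 : 2 ≤ d + 1)
    (hb₀ : 0 < b₀)
    {cthr α₀ : ℝ} (hc : cthr ≤ 10) (hα : 0 ≤ α₀) {U : CfgV1 (PV d ℓ x.m x.K hd hL) (Matrix (Fin N) (Fin N) ℂ)}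
    (hreg : (bg9YP (Matrix (Fin N) (Fin N) ℂ) G x).Reg335 cthr α₀ U)
    {loc : FBondY x.toKIdx × (Fin N × Fin N) → UT Nf} {R R' ρ B : ℝ}
    (hA : RawEntryLetters (fun a : Fin (d + 1) → Site (PV d ℓ x.m x.K hd hL) 0 → Matrix (Fin N) (Fin N) ℂ =>
      LinearMap.toMatrix
        ((Pi.basis fun _ : FBondY x.toKIdx => Matrix.stdBasis ℂ (Fin N) (Fin N)).reindex (Equiv.sigmaEquivProd (FBondY x.toKIdx) (Fin N × Fin N)))
        ((Pi.basis fun _ : FBondY x.toKIdx => Matrix.stdBasis ℂ (Fin N) (Fin N)).reindex (Equiv.sigmaEquivProd (FBondY x.toKIdx) (Fin N × Fin N)))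
        (padDeltaALocY x.toKIdx (parSymY x.toKIdx) (parBY x.toKIdx) (cubeDomY x c) (cutMulY χP) (cutMulY χ)
          (prodCfg (1 : CfgY (Matrix (Fin N) (Fin N) ℂ) x.toKIdx) (kGeo x.toKIdx).eta a))) loc R ρ B)
    (hρ : 0 < ρ) {mF : ℕ} (hfib : ∀ y : UT Nf, (univ.filter fun k => loc k = y).card ≤ mF)
    (hR' : 0 < R') (hR'R : R' ≤ R)
    (hsmall : 2 * (B * (mF * B6.c0 1 ρ ^ ν)) * R' <
      min 1 (2 / ((12 * (((d + 1 : ℕ) : ℝ)) ^ 2 * (1 + 12 * (((d + 1 : ℕ) : ℝ)) * ((((ℓ + 1 : ℕ) : ℝ)) ^ (x.toKIdx.k - 1)) ^ 2))⁻¹ *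
                (((((ℓ + 1 : ℕ) : ℝ)) ^ (x.toKIdx.k - 1 + 1)) ^ (d + 1 + 1))⁻¹ *
                  min (x.toKIdx.cf ^ 2 / 2) (b₀ * x.toKIdx.cf ^ 2 / ((((ℓ + 1 : ℕ) : ℝ)) ^ (x.toKIdx.k - 1 + 1)) ^ (d + 1 - 2))) +
            4 / (8 * x.toKIdx.cf ^ 2 / ((((ℓ + 1 : ℕ) : ℝ)) ^ x.toKIdx.k) ^ 2) *
              (1 + 4 * ((d + 1 : ℕ) : ℝ) * x.toKIdx.cf ^ 2 /
                ((12 * (((d + 1 : ℕ) : ℝ)) ^ 2 * (1 + 12 * (((d + 1 : ℕ) : ℝ)) * ((((ℓ + 1 : ℕ) : ℝ)) ^ (x.toKIdx.k - 1)) ^ 2))⁻¹ *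
                  (((((ℓ + 1 : ℕ) : ℝ)) ^ (x.toKIdx.k - 1 + 1)) ^ (d + 1 + 1))⁻¹ *
                    min (x.toKIdx.cf ^ 2 / 2) (b₀ * x.toKIdx.cf ^ 2 / ((((ℓ + 1 : ℕ) : ℝ)) ^ (x.toKIdx.k - 1 + 1)) ^ (d + 1 - 2)))))⁻¹ * R)
    (hCr : 2 * (kGeo x.toKIdx).L ^ 4 * ((kGeo x.toKIdx).M * α₀) * (scaleLen (kGeo x.toKIdx).L (kGeo x.toKIdx).eta c.1.1)⁻¹ ≤ R') :
    PosDefTr (fun _ => (1 : ℝ)) (padDeltaALocY x.toKIdx (parSymY x.toKIdx) (parBY x.toKIdx) (cubeDomY x c) (cutMulY χP) (cutMulY χ) U) :=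
  posDefTr_padDeltaALocY_of_L5_of_regYP335 x c χP hχD hc hα hreg hA hρ hfib
    (coer_trIP_padDeltaALocY_one_cubeDomY_of_KIdx x c hd2 hb₀ hχP hχ hχD) hR' hR'R hsmall hCr

end Summit.QuantumFields.YangMills.BalabanUVNodes.N06Row17LocalCentreEveryCubeOfKIdx

end
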